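import Mathlib
import Summits.Ventures.PercRepro2.Defs
import Summits.Ventures.PercRepro2.Graph
import Summits.Ventures.PercRepro2.OneColourSwitch
import Summits.Ventures.PercRepro2.RegionHubSign
import Summits.Ventures.PercRepro2.SideSwitch
import Summits.Ventures.PercRepro2.SideSwitchFibre
import Summits.Ventures.PercRepro2.SideSwitchClosed
import Summits.Ventures.PercRepro2.SideSwitchComps
import Summits.Ventures.PercRepro2.M9NoPocketDefs
import Summits.Ventures.PercRepro2.M9NoPocketWorld
import Summits.Ventures.PercRepro2.M9NoPocketWorldD
import Summits.Ventures.PercRepro2.M9NoPocketLegal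
import Summits.Ventures.PercRepro2.M9NoPocketCompl
import Summits.Ventures.PercRepro2.M9PsiOneDefs
import Summits.Ventures.PercRepro2.M9NoPocketFreeBlock
import Summits.Ventures.PercRepro2.M9NoPocketFreeBlockK
import Summits.Ventures.PercRepro2.M9NoPocketSameType
import Summits.Ventures.PercRepro2.M9NoPocketDeadPattern
import Summits.Ventures.PercRepro2.M9NoPocketLinkCompl
import Summits.Ventures.PercRepro2.M9NoPocketLinkE
import Summits.Ventures.PercRepro2.M9NoPocketSigmaRS
import Summits.Ventures.PercRepro2.M9NoPocketUnitK

/-!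
# Good edges: the link through `d` when no joined block links internally (blind cell
PercRepro2, p3 g36, 2026-08-29; `proofs/P3-NPHDR.md` §5′(c′))

An edge `e = d–y` of `d` into the block `C` is GOOD FOR THE ROOT `a ∈ {r, s}` when `a` reaches
`y` inside `C ∪ {a}` in the representative.  With every free block switched, a `Y`-link `r ~ s`
of a point of a dead pattern must pass through `d` when no joined block links internally, so it
yields a live edge good for `r` into an unswitched block and one good for `s`
(`exists_good_of_conn`); conversely two such edges give the link (`conn_of_good`).  Every
edge of `d` is good for some root (`good_of_edge`: a block vertex is `Y`-joined to `r` or `s`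
in `G − d`, and a block is entered only through `r, s`).  Own work; std axioms.
-/

namespace Summit.Ventures.PercRepro2

namespace NoPocket

open Finset Classical RegionHub OneColourSwitch SideSwitch

variable {V : Type*} {E : Type*}

section GoodEdge

variable [Fintype V] [DecidableEq V] [Fintype E] [DecidableEq E] {ends : E → Sym2 V}

omit [Fintype E] [DecidableEq E] in
/-- A block is closed under edges of `G − d` into sided vertices. -/
lemma mem_block_of_edge {d r s : V} {ρ : Config E} {C C' : Finset V}
    (hC : C ∈ blocks ends d r s ρ) (hC' : C' ∈ blocks ends d r s ρ) {z v : V} (hz : z ∈ C)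
    (hv : v ∈ C') {e : E} (hends : ends e = s(z, v)) (hzd : z ≠ d) (hvd : v ≠ d) : v ∈ C := by
  have hcl := closedIn_of_mem_comps (ends := endsD ends d) hC
  rw [sided_eq_coe_A0] at hcl
  have hvA : v ∈ A0 (endsD ends d) r s ρ := subset_A0_of_mem_comps (ends := endsD ends d) hC' hv
  have hnd : d ∉ ends e := notMem_of_ends_ne hends hzd hvd
  exact Finset.mem_coe.1 (hcl e z v (by rw [endsD_of_notMem hnd]; exact hends)
    (Finset.mem_coe.2 hz) (Finset.mem_coe.2 hvA))

/-- The edges inside `C ∪ {a}` of an unswitched block of a dead pattern keep the colour of the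
same-type representative. -/
lemma assignX_flipF_eq_of_within {p q r s d : V} {ρ₀ : Config E} (hρ₀ : ρ₀ ∈ RepD ends p q r s d)
    (hr : d ≠ r) (hs : d ≠ s) (hT : Tset ends d r s = ∅) {D : Finset E} (hD : ∀ e ∈ D, d ∈ ends e)
    {X : Finset (Finset V)} (hX : X ⊆ blocks ends d r s ρ₀) {C : Finset V}
    (hC : C ∈ blocks ends d r s ρ₀) (hCX : C ∉ X) {a : V} (ha : a = r ∨ a = s) {e : E}
    (he : e ∈ within ends (↑C ∪ {a} : Set V)) : assignX ends (X, ∅) (flipF D ρ₀) e = ρ₀ e := by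
  have hρD := flipF_mem_RepD hρ₀ hT hD
  have hb := blocks_flipF (ends := ends) (r := r) (s := s) (ρ := ρ₀) hD
  have hX' : X ⊆ blocks ends d r s (flipF D ρ₀) := by rw [hb]; exact hX
  have hC' : C ∈ blocks ends d r s (flipF D ρ₀) := by rw [hb]; exact hC
  have he' : e ∈ within ends (↑C ∪ {r, s} : Set V) := by
    obtain ⟨x, hx, y, hy, hends⟩ := he
    refine ⟨x, ?_, y, ?_, hends⟩
    · rcases hx with hx | hx
      · exact Or.inl hx
      · rw [Set.mem_singleton_iff] at hx
        rcases ha with rfl | rfl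
        · exact Or.inr (Or.inl hx)
        · exact Or.inr (Or.inr hx)
    · rcases hy with hy | hy
      · exact Or.inl hy
      · rw [Set.mem_singleton_iff] at hy
        rcases ha with rfl | rfl
        · exact Or.inr (Or.inl hy)
        · exact Or.inr (Or.inr hy)
  rw [assignX_eq_of_within hρD hr hs hX' rfl hC' hCX he']
  exact (flipF_eqOn_off_d (ends := ends) (ρ := ρ₀) hD e
    (d_notMem_ends_of_within_block hr hs hC he')).symm

omit [Fintype E] in
/-- An edge of `d` into an unswitched block keeps its colour in the dead pattern's assignment
(it touches no switched block). -/
lemma assignX_flipF_at_d {d r s : V} (hr : d ≠ r) (hs : d ≠ s) {ρ₀ : Config E} {D : Finset E}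
    {X : Finset (Finset V)} (hX : X ⊆ blocks ends d r s ρ₀) {C : Finset V}
    (hC : C ∈ blocks ends d r s ρ₀) (hCX : C ∉ X) {y : V} (hy : y ∈ C) {e : E}
    (hends : ends e = s(d, y)) : assignX ends (X, ∅) (flipF D ρ₀) e = flipF D ρ₀ e := by
  have hnt : e ∉ touches ends (↑(unionT X) : Set V) := by
    rintro ⟨w, hw, z, hwz⟩
    obtain ⟨C', hC', hwC'⟩ := mem_unionT.1 (Finset.mem_coe.1 hw)
    have hwe : w ∈ ends e := by rw [hwz]; exact Sym2.mem_mk_left _ _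
    rw [hends, Sym2.mem_iff] at hwe
    rcases hwe with rfl | rfl
    · exact d_notMem_block hr hs (hX hC') hwC'
    · exact hCX (by rw [blocks_eq_of_shared_vertex hC (hX hC') hy hwC']; exact hC')
  simp only [assignX, flipTouch, flipF, hnt, if_false, Finset.notMem_empty]

omit [Fintype V] [DecidableEq V] [Fintype E] [DecidableEq E] in
/-- `C ∪ {a} ⊆ C ∪ {r, s}` for a root `a`. -/
lemma coe_union_root_subset {r s a : V} (ha : a = r ∨ a = s) (C : Finset V) :
    (↑C ∪ {a} : Set V) ⊆ ↑C ∪ {r, s} := by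
  intro w hw
  rcases hw with hw | hw
  · exact Or.inl hw
  · rw [Set.mem_singleton_iff] at hw
    rcases ha with rfl | rfl
    · exact Or.inr (Or.inl hw)
    · exact Or.inr (Or.inr hw)

omit [Fintype V] [DecidableEq E] in
/-- An edge from a root to `d` is a `T`-edge. -/
lemma mem_Tset_of_ends_root {d r s a : V} (ha : a = r ∨ a = s) {e : E} (hends : ends e = s(a, d)) :
    e ∈ Tset ends d r s := by
  rw [mem_Tset, hends, Sym2.eq_swap]
  rcases ha with rfl | rfl
  · exact Or.inl rfl
  · exact Or.inr rfl

omit [Fintype V] [DecidableEq V] [Fintype E] [DecidableEq E] in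
/-- A connection `a ~ b` inside `C ∪ {a, b}` of the two roots is the internal link. -/
lemma linksIn_of_conn_roots {r s a b : V} (hab : (a = r ∧ b = s) ∨ (a = s ∧ b = r))
    {ρ : Config E} {C : Finset V} (h : Conn ends (restrictTo ends ρ (↑C ∪ {a, b})) a b) :
    LinksIn ends ρ r s C := by
  unfold LinksIn
  rcases hab with ⟨rfl, rfl⟩ | ⟨rfl, rfl⟩
  · exact h
  · have hset : (↑C ∪ {a, b} : Set V) = ↑C ∪ {b, a} := by
      ext w
      simp only [Set.mem_union, Set.mem_insert_iff, Set.mem_singleton_iff]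
      tauto
    rw [hset] at h
    exact conn_symm h

/-- **A `Y`-link of a point with every free block switched yields a live good edge into an
unswitched block, for each root** (no joined block links internally). -/
theorem exists_good_of_conn {p q r s d : V} (hnp : NoPocketAt ends d r s) (hr : d ≠ r)
    (hs : d ≠ s) (hT : Tset ends d r s = ∅) (hrs : ∀ e, ends e ≠ s(r, s)) (hrs' : r ≠ s)
    {ρ₀ : Config E} (hρ₀ : ρ₀ ∈ RepD ends p q r s d) (hst : ∀ e, d ∈ ends e → ρ₀ e = true)
    (hnl : ∀ C ∈ blocks ends d r s ρ₀, hasY ends d ρ₀ C → ¬ LinksIn ends ρ₀ r s C)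
    {D : Finset E} (hD : ∀ e ∈ D, d ∈ ends e) {X : Finset (Finset V)}
    (hX : X ⊆ blocks ends d r s ρ₀)
    (hXf : (blocks ends d r s ρ₀).filter (fun C => ¬ hasY ends d ρ₀ C) ⊆ X)
    (hx : ((X, ∅) : Finset (Finset V) × Finset E) ∈ L4 ends d r s (flipF D ρ₀))
    {a b : V} (hab : (a = r ∧ b = s) ∨ (a = s ∧ b = r))
    (hc : Conn ends (assignX ends (X, ∅) (flipF D ρ₀)) a b) :
    ∃ e, e ∉ D ∧ ∃ C ∈ blocks ends d r s ρ₀, C ∉ X ∧ ∃ y ∈ C, ends e = s(d, y) ∧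
      Conn ends (restrictTo ends ρ₀ (↑C ∪ {a})) a y := by
  have hρD := flipF_mem_RepD hρ₀ hT hD
  have hb := blocks_flipF (ends := ends) (r := r) (s := s) (ρ := ρ₀) hD
  have hX' : X ⊆ blocks ends d r s (flipF D ρ₀) := by rw [hb]; exact hX
  have ha : a = r ∨ a = s := by
    rcases hab with ⟨h, _⟩ | ⟨h, _⟩
    · exact Or.inl h
    · exact Or.inr h
  have hab' : ∀ e, ends e ≠ s(a, b) := by
    intro e
    rcases hab with ⟨rfl, rfl⟩ | ⟨rfl, rfl⟩
    · exact hrs e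
    · rw [Sym2.eq_swap]; exact hrs e
  have hne : a ≠ b := by
    rcases hab with ⟨rfl, rfl⟩ | ⟨rfl, rfl⟩
    · exact hrs'
    · exact hrs'.symm
  have hbblock : ∀ C ∈ blocks ends d r s ρ₀, b ∉ C := by
    intro C hC
    rcases hab with ⟨_, rfl⟩ | ⟨_, rfl⟩
    · exact (r_notMem_block hρ₀ hC).2
    · exact (r_notMem_block hρ₀ hC).1
  set ω := assignX ends (X, ∅) (flipF D ρ₀) with hω
  -- the `Y`-world of the point, read with the roots `a, b`
  have hK : ∀ v ∈ K2 ends r s ω, v = a ∨ v = b ∨ v = d ∨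
      ∃ C ∈ blocks ends d r s ρ₀, C ∉ X ∧ v ∈ C := by
    intro v hv
    obtain ⟨⟨_, hF⟩, _, hLY⟩ := mem_L4.1 hx
    rw [K2_assignX hnp hρD hX' hF hr hs hLY] at hv
    rcases hv with hv | ⟨rfl, _⟩
    · rw [K2_endsD_assignX hρD hX' hF, K2_endsD_eq_of_eqOn
        (fun e he => (flipF_eqOn_off_d (ends := ends) (ρ := ρ₀) hD e he).symm)] at hv
      obtain ⟨hvK, hvX⟩ := hv
      rcases mem_A0_of_mem_K2_endsD hvK with h | h | h
      · rcases hab with ⟨rfl, rfl⟩ | ⟨rfl, rfl⟩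
        · exact Or.inl h
        · exact Or.inr (Or.inl h)
      · rcases hab with ⟨rfl, rfl⟩ | ⟨rfl, rfl⟩
        · exact Or.inr (Or.inl h)
        · exact Or.inl h
      · obtain ⟨hC, hvC⟩ := block_of_mem_A0 (ends := ends) (r := r) (s := s) (ρ := ρ₀) h
        exact Or.inr (Or.inr (Or.inr ⟨_, hC, block_notMem_of_notMem_unionT hρ₀ hX hC hvC
          (fun h' => hvX (Finset.mem_coe.2 h')), hvC⟩))
    · exact Or.inr (Or.inr (Or.inl rfl))
  have haK : a ∈ K2 ends r s ω := by
    rcases ha with ha | ha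
    · rw [ha]; exact r_mem_K2 r s ω
    · rw [ha]; exact s_mem_K2 r s ω
  -- the closure set
  have key : b ∈ {z | z ∈ K2 ends r s ω ∧ ((∃ e, e ∉ D ∧ ∃ C ∈ blocks ends d r s ρ₀, C ∉ X ∧
      ∃ y ∈ C, ends e = s(d, y) ∧ Conn ends (restrictTo ends ρ₀ (↑C ∪ {a})) a y) ∨ z = a ∨
      ∃ C ∈ blocks ends d r s ρ₀, C ∉ X ∧ z ∈ C ∧
        Conn ends (restrictTo ends ω (↑C ∪ {a})) a z)} := by
    refine mem_of_conn_of_closed (ends := ends) (ω := ω) ?_ ⟨haK, Or.inr (Or.inl rfl)⟩ hc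
    rintro z ⟨hzK, hz⟩ v hadj
    obtain ⟨hzv, e, he, hends⟩ := openGraph_adj.1 hadj
    have hvK : v ∈ K2 ends r s ω := mem_K2_of_open hzK he hends
    refine ⟨hvK, ?_⟩
    rcases hz with hP | hza | ⟨C, hC, hCX, hzC, hz⟩
    · exact Or.inl hP
    · -- from the root `a`
      rw [hza] at hends
      rcases hK v hvK with hva | hvb | hvd | ⟨C, hC, hCX, hvC⟩
      · exact Or.inr (Or.inl hva)
      · rw [hvb] at hends
        exact absurd hends (hab' e)
      · exfalso
        rw [hvd] at hends
        have := mem_Tset_of_ends_root ha hends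
        rw [hT] at this
        exact Finset.notMem_empty e this
      · refine Or.inr (Or.inr ⟨C, hC, hCX, hvC, conn_of_openAdj ⟨e, ?_, hends⟩⟩)
        unfold restrictTo
        rw [if_pos ⟨a, Or.inr rfl, v, Or.inl (Finset.mem_coe.2 hvC), hends⟩]
        exact he
    · -- inside the unswitched block `C`
      by_cases hvC : v ∈ C
      · refine Or.inr (Or.inr ⟨C, hC, hCX, hvC, conn_trans hz (conn_of_openAdj ⟨e, ?_, hends⟩)⟩)
        unfold restrictTo
        rw [if_pos ⟨z, Or.inl (Finset.mem_coe.2 hzC), v, Or.inl (Finset.mem_coe.2 hvC), hends⟩]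
        exact he
      have hzd : z ≠ d := (block_vertex_ne hρ₀ hC hzC hr hs).2.2
      have hCY : hasY ends d ρ₀ C := by
        by_contra hY
        exact hCX (hXf (Finset.mem_filter.2 ⟨hC, hY⟩))
      -- the edges inside `C ∪ {a}` of `ω` are those of `ρ₀`
      have heq : restrictTo ends ω (↑C ∪ {a}) = restrictTo ends ρ₀ (↑C ∪ {a}) :=
        restrictTo_congr (fun e' he' => assignX_flipF_eq_of_within hρ₀ hr hs hT hD hX hC hCX ha he')
      rcases hK v hvK with hva | hvb | hvd | ⟨C', hC', _, hvC'⟩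
      · exact Or.inr (Or.inl hva)
      · -- `a ~ z ~ b` inside `C ∪ {a, b}`: the block links
        exfalso
        rw [hvb] at hends
        refine hnl C hC hCY (linksIn_of_conn_roots hab ?_)
        have hsub : (↑C ∪ {a} : Set V) ⊆ ↑C ∪ {a, b} := by
          intro w hw
          rcases hw with hw | hw
          · exact Or.inl hw
          · rw [Set.mem_singleton_iff] at hw
            exact Or.inr (Or.inl hw)
        have h1 : Conn ends (restrictTo ends ρ₀ (↑C ∪ {a, b})) a z :=
          conn_mono (restrictTo_mono_set hsub) (heq ▸ hz)
        have h2 : Conn ends (restrictTo ends ρ₀ (↑C ∪ {a, b})) z b := by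
          refine conn_of_openAdj ⟨e, ?_, hends⟩
          unfold restrictTo
          rw [if_pos ⟨z, Or.inl (Finset.mem_coe.2 hzC), b, Or.inr (Or.inr rfl), hends⟩]
          have hw : e ∈ within ends (↑C ∪ {b} : Set V) :=
            ⟨z, Or.inl (Finset.mem_coe.2 hzC), b, Or.inr rfl, hends⟩
          have hb' : b = r ∨ b = s := by
            rcases hab with ⟨_, h⟩ | ⟨_, h⟩
            · exact Or.inr h
            · exact Or.inl h
          rw [← assignX_flipF_eq_of_within hρ₀ hr hs hT hD hX hC hCX hb' hw]
          exact he
        exact conn_trans h1 h2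
      · -- the edge into `d` is live and good for `a`
        rw [hvd] at hends
        refine Or.inl ⟨e, ?_, C, hC, hCX, z, hzC, by rw [hends, Sym2.eq_swap], heq ▸ hz⟩
        intro heD
        have := assignX_flipF_at_d hr hs hX hC hCX hzC (D := D) (by rw [hends, Sym2.eq_swap])
        rw [← hω] at this
        rw [this, flipF_of_mem heD, hst e (hD e heD)] at he
        exact Bool.noConfusion he
      · -- another unswitched block: impossible, blocks are closed
        exfalso
        have hvd : v ≠ d := (block_vertex_ne hρ₀ hC' hvC' hr hs).2.2
        exact hvC (mem_block_of_edge hC hC' hzC hvC' hends hzd hvd)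
  obtain ⟨_, hP | hba | ⟨C, hC, _, hbC, _⟩⟩ := key
  · exact hP
  · exact absurd hba.symm hne
  · exact absurd hbC (hbblock C hC)

end GoodEdge

end NoPocket

end Summit.Ventures.PercRepro2
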